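import Summits.CriticalPhenomena.CardyFormulaZ2.Theorems.CardyBoundaryCoulombGasBoundaryDefectGaussianRStubTransportPathsPart11

/-!
# Stub `stub_transportPaths` of line `rainbow-monomials-in-excursion-kernels` — Part 19:
# uniform constants of the polygon over one period (corner radius, edge lengths)
# (crux `CardyBoundaryCoulombGas.BoundaryDefectGaussianR`, stmt-CriticalPhenomena-14132)

Everything about the polygon of Part 8 is `M`-periodic in the edge index (`tp_point_shift`,
`tp_a_shift`, `tp_τ_shift`), so pointwise positive data have uniform positive bounds:

* `tp_corner_radius` — one radius `R_c > 0` for the closure charts at ALL corners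
  (the input radius of `tp_corner_jump`, Part 17: `ρ + 16 δ ≤ R_c`);
* `tp_edge_lengths` — `0 < ℓmin ≤ ‖γ (c (z+1)) - γ (c z)‖ ≤ Λ` for all `z` (edges long enough to
  carry the take-off and landing points; the bound `T δ_n ≤ N` of TRANSPORT with
  `N ∼ k (M + 1) (Λ + 1)`).
All [folklore].
-/

noncomputable section

open Set Filter Metric Topology
open Literature.Probability.RandomPlanarGeometry
open Summit.CriticalPhenomena.CardyFormulaZ2.Cruxes.RectilinearCardy.ExcursionKernelCovariance

namespace Summit.CriticalPhenomena.CardyFormulaZ2.Cruxes.BoundaryDefectGaussianR.RainbowMonomialsInExcursionKernels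

/-- Corners repeat after one period: `γ (c (z + n M)) = γ (c z)`. [folklore] -/
theorem tp_point_shift (D : JordanDomain) {M : ℕ} {c : ℤ → ℝ} (hcper : ∀ z, c (z + M) = c z + 1)
    (z n : ℤ) : D.boundary (c (z + n * M)) = D.boundary (c z) := by
  rw [tp_c_shift hcper z n]
  have := (D.periodic_boundary.int_mul n) (c z)
  rwa [mul_one] at this

/-- Edge directions repeat after any number of periods. [folklore] -/
theorem tp_a_shift (D : JordanDomain) {M : ℕ} {c : ℤ → ℝ} {a : ℤ → ℕ}
    (hcmono : StrictMono c) (hcper : ∀ z, c (z + M) = c z + 1) (ha4 : ∀ z, a z < 4)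
    (hdir : ∀ z, ∀ t ∈ Icc (c z) (c (z + 1)), D.boundary t =
      D.boundary (c z) + ((‖D.boundary t - D.boundary (c z)‖ : ℝ) : ℂ) * Complex.I ^ (a z))
    (hmono : ∀ z, StrictMonoOn (fun t => ‖D.boundary t - D.boundary (c z)‖) (Icc (c z) (c (z + 1)))) :
    ∀ (z n : ℤ), a (z + n * M) = a z := by
  have hp := tp_a_periodic D hcmono hcper ha4 hdir hmono
  intro z n
  induction n using Int.induction_on generalizing z with
  | zero => simp
  | succ n ih =>
    rw [show z + (↑n + 1) * ↑M = (z + ↑n * ↑M) + ↑M by ring, hp, ih]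
  | pred n ih =>
    have h := hp (z + (-↑n - 1) * ↑M)
    rw [show z + (-↑n - 1) * ↑M + ↑M = z + -↑n * ↑M by ring, ih] at h
    exact h.symm

/-- Corner types repeat after any number of periods. [folklore] -/
theorem tp_τ_shift {M : ℕ} {a τ : ℤ → ℕ} (hτ : ∀ z, τ z = 1 ∨ τ z = 3)
    (hmodτ : ∀ z, (a z + τ z) % 4 = (a (z - 1) + 2) % 4)
    (hash : ∀ (z n : ℤ), a (z + n * M) = a z) :
    ∀ (z n : ℤ), τ (z + n * M) = τ z := by
  intro z n
  have h1 := hmodτ (z + n * M)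
  have h2 := hmodτ z
  rw [hash z n, show z + n * ↑M - 1 = (z - 1) + n * ↑M by ring, hash (z - 1) n] at h1
  rcases hτ z with h | h <;> rcases hτ (z + n * M) with h' | h' <;> omega

/-- **A uniform corner radius.** If every corner `γ (c z)` carries a closure chart (closed
sector of `τ z` quadrants in the frame `a z`) at some positive radius, then one radius
`R_c > 0` serves all corners (minimum over one period; periodicity). [folklore] -/
theorem tp_corner_radius (D : JordanDomain) {M : ℕ} {c : ℤ → ℝ} {a τ : ℤ → ℕ} (hM : 0 < M)
    (hcper : ∀ z, c (z + M) = c z + 1)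
    (hash : ∀ (z n : ℤ), a (z + n * M) = a z) (hτsh : ∀ (z n : ℤ), τ (z + n * M) = τ z)
    (hcornerch : ∀ z, ∃ r : ℝ, 0 < r ∧ (∀ w, dist w (D.boundary (c z)) < r → (w ∈ frontier D.carrier ↔
      (((w - D.boundary (c z)) * (-Complex.I) ^ a z).im = 0 ∧ 0 ≤ ((w - D.boundary (c z)) *
      (-Complex.I) ^ a z).re) ∨ (((w - D.boundary (c z)) * (-Complex.I) ^ (a z + τ z)).im = 0 ∧ 0
      ≤ ((w - D.boundary (c z)) * (-Complex.I) ^ (a z + τ z)).re))) ∧ (∀ w, dist w (D.boundary (c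
      z)) < r → (w ∈ D.carrier ↔ ((τ z = 1 → 0 < ((w - D.boundary (c z)) * (-Complex.I) ^ a z).re
      ∧ 0 < ((w - D.boundary (c z)) * (-Complex.I) ^ a z).im) ∧ (τ z = 2 → 0 < ((w - D.boundary (c
      z)) * (-Complex.I) ^ a z).im) ∧ (τ z = 3 → 0 < ((w - D.boundary (c z)) * (-Complex.I) ^ a
      z).im ∨ ((w - D.boundary (c z)) * (-Complex.I) ^ a z).re < 0)))) ∧ (∀ w, dist w (D.boundary
      (c z)) < r → (w ∈ closure D.carrier ↔ ((τ z = 1 → 0 ≤ ((w - D.boundary (c z)) * (-Complex.I)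
      ^ a z).re ∧ 0 ≤ ((w - D.boundary (c z)) * (-Complex.I) ^ a z).im) ∧ (τ z = 2 → 0 ≤ ((w -
      D.boundary (c z)) * (-Complex.I) ^ a z).im) ∧ (τ z = 3 → 0 ≤ ((w - D.boundary (c z)) *
      (-Complex.I) ^ a z).im ∨ ((w - D.boundary (c z)) * (-Complex.I) ^ a z).re ≤ 0))))) :
    ∃ R : ℝ, 0 < R ∧ ∀ z, (∀ w, dist w (D.boundary (c z)) < R → (w ∈ closure D.carrier ↔ ((τ z = 1 → 0 ≤ ((w - D.boundary (c z)) * (-Complex.I) ^ a z).re ∧ 0 ≤ ((w - D.boundary (c z)) * (-Complex.I) ^ a z).im) ∧ (τ z = 2 → 0 ≤ ((w - D.boundary (c z)) * (-Complex.I) ^ a z).im) ∧ (τ z = 3 → 0 ≤ ((w - D.boundary (c z)) * (-Complex.I) ^ a z).im ∨ ((w - D.boundary (c z)) * (-Complex.I) ^ a z).re ≤ 0)))) := by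
  classical
  choose rC hrC hch using hcornerch
  have hne : (Finset.range M).Nonempty := ⟨0, Finset.mem_range.2 hM⟩
  obtain ⟨m₀, hm₀, hmin⟩ := (Finset.range M).exists_min_image (fun m : ℕ => rC (m : ℤ)) hne
  refine ⟨rC (m₀ : ℤ), hrC _, fun z => ?_⟩
  -- reduce `z` to its residue
  have hM0 : (0 : ℤ) < M := by exact_mod_cast hM
  set q := z / M with hq
  set r := z % M with hr
  have hr0 : 0 ≤ r := Int.emod_nonneg z hM0.ne'
  have hrM : r < M := Int.emod_lt_of_pos z hM0
  have hz : z = r + q * M := by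
    have := Int.emod_add_mul_ediv z M
    rw [← hr, ← hq] at this
    linarith
  have hrn : ((r.toNat : ℕ) : ℤ) = r := Int.toNat_of_nonneg hr0
  have hle : rC (m₀ : ℤ) ≤ rC r := by
    have h := hmin r.toNat (Finset.mem_range.2 (by omega))
    rwa [hrn] at h
  have hP : D.boundary (c z) = D.boundary (c r) := by rw [hz]; exact tp_point_shift D hcper r q
  have ha : a z = a r := by rw [hz]; exact hash r q
  have hτ' : τ z = τ r := by rw [hz]; exact hτsh r q
  obtain ⟨-, -, hcl⟩ := hch r
  intro w hw
  rw [hP] at hw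
  rw [hP, ha, hτ']
  exact hcl w (lt_of_lt_of_le hw hle)

/-- **Uniform edge lengths.** `0 < ℓmin ≤ ‖γ (c (z+1)) - γ (c z)‖ ≤ Λ` for all edges.
[folklore] -/
theorem tp_edge_lengths (D : JordanDomain) {M : ℕ} {c : ℤ → ℝ} (hM : 0 < M)
    (hcmono : StrictMono c) (hcper : ∀ z, c (z + M) = c z + 1)
    (hmono : ∀ z, StrictMonoOn (fun t => ‖D.boundary t - D.boundary (c z)‖) (Icc (c z) (c (z + 1)))) :
    ∃ ℓmin Λ : ℝ, 0 < ℓmin ∧ ∀ z, ℓmin ≤ ‖D.boundary (c (z + 1)) - D.boundary (c z)‖ ∧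
      ‖D.boundary (c (z + 1)) - D.boundary (c z)‖ ≤ Λ := by
  classical
  set ℓ : ℤ → ℝ := fun z => ‖D.boundary (c (z + 1)) - D.boundary (c z)‖ with hℓ
  have hℓpos : ∀ z, 0 < ℓ z := by
    intro z
    have h := hmono z ⟨le_rfl, (hcmono (by omega : z < z + 1)).le⟩
      ⟨(hcmono (by omega : z < z + 1)).le, le_rfl⟩ (hcmono (by omega : z < z + 1))
    simp only [sub_self, norm_zero] at h
    exact h
  have hℓper : ∀ (z n : ℤ), ℓ (z + n * M) = ℓ z := by
    intro z n
    simp only [hℓ]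
    rw [show z + n * ↑M + 1 = (z + 1) + n * ↑M by ring, tp_point_shift D hcper (z + 1) n,
      tp_point_shift D hcper z n]
  have hne : (Finset.range M).Nonempty := ⟨0, Finset.mem_range.2 hM⟩
  obtain ⟨m₀, hm₀, hmin⟩ := (Finset.range M).exists_min_image (fun m : ℕ => ℓ (m : ℤ)) hne
  obtain ⟨m₁, hm₁, hmax⟩ := (Finset.range M).exists_max_image (fun m : ℕ => ℓ (m : ℤ)) hne
  refine ⟨ℓ (m₀ : ℤ), ℓ (m₁ : ℤ), hℓpos _, fun z => ?_⟩
  have hM0 : (0 : ℤ) < M := by exact_mod_cast hM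
  set q := z / M with hq
  set r := z % M with hr
  have hr0 : 0 ≤ r := Int.emod_nonneg z hM0.ne'
  have hrM : r < M := Int.emod_lt_of_pos z hM0
  have hz : z = r + q * M := by
    have := Int.emod_add_mul_ediv z M
    rw [← hr, ← hq] at this
    linarith
  have hrn : ((r.toNat : ℕ) : ℤ) = r := Int.toNat_of_nonneg hr0
  have hmem : r.toNat ∈ Finset.range M := Finset.mem_range.2 (by omega)
  have e : ℓ z = ℓ r := by rw [hz]; exact hℓper r q
  change ℓ (m₀ : ℤ) ≤ ℓ z ∧ ℓ z ≤ ℓ (m₁ : ℤ)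
  rw [e]
  have h1 := hmin r.toNat hmem
  have h2 := hmax r.toNat hmem
  rw [hrn] at h1 h2
  exact ⟨h1, h2⟩

/-- **Registered sub-goal `s7_edgeLengths` of stub `stub_transportPaths`** (uniform edge lengths,
one-line form of `tp_edge_lengths`). [folklore] -/
theorem s7_edgeLengths : ∀ (D : Literature.Probability.RandomPlanarGeometry.JordanDomain) (M : ℕ) (c : ℤ → ℝ), (0 < M) → (StrictMono c) → (∀ z, c (z + M) = c z + 1) → (∀ z, StrictMonoOn (fun t => ‖D.boundary t - D.boundary (c z)‖) (Set.Icc (c z) (c (z + 1)))) → ∃ ℓmin Λ : ℝ, 0 < ℓmin ∧ ∀ z, ℓmin ≤ ‖D.boundary (c (z + 1)) - D.boundary (c z)‖ ∧ ‖D.boundary (c (z + 1)) - D.boundary (c z)‖ ≤ Λ :=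
  fun D _ _ hM hcmono hcper hmono => tp_edge_lengths D hM hcmono hcper hmono

end Summit.CriticalPhenomena.CardyFormulaZ2.Cruxes.BoundaryDefectGaussianR.RainbowMonomialsInExcursionKernels

end
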